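import Summits.AtomisticToContinuum.Crystallization.Theorems.PricedLinkCensusLocalToGlobalThomsonKernelBounds
import Summits.AtomisticToContinuum.Crystallization.Theorems.PricedLinkCensusLocalToGlobalThomsonCutoff
import Literature.Analysis.FluidPDE.PressurePoisson

/-!
# Regularised Newton potentials of bounded densities in `ℝ⁸`: regularity, decay, energy identity

Route `PricedLinkCensus`, crux `LocalToGlobal` (stmt-AtomisticToContinuum-14232), line
`flux-cell-joint-census`, support for the registered stub `stub_confinedThomson : ConfinedThomson`.
For a bounded density `ρ` vanishing off `B̄(0, R₀)` and the regularised kernel `f_t = newtonFar8 t`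
(`PricedLinkCensusLocalToGlobalThomsonKernel`), the potential

  `v = farPotential t ρ = ∫ ρ(z) f_t(· - z) dz`

is smooth with `Dv = ∫ ρ(z) Df_t(· - z) dz`, `Δv = ∫ ρ(z) (Δf_t)(· - z) dz` (tree
`Literature/Analysis/FluidPDE/HarmonicProbe`: differentiation under the integral sign for `L¹` kernels
vanishing off a ball), decays like `|v| ≲ (1 + ‖x‖)⁻⁶`, `‖Dv‖ ≲ (1 + ‖x‖)⁻⁷` (so `v, ∇v ∈ L²(ℝ⁸)`), its
Laplacian is continuous with compact support, `∇v` has weak divergence `Δv`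
(`∫⟪∇v, ∇φ⟫ = -∫ Δv φ`, Green), and the **energy identity** `∫ ⟪∇v, ∇v⟫ = -∫ Δv · v` holds
(cut-off removal, `PricedLinkCensusLocalToGlobalThomsonCutoff`).  Also here: the KERNEL EXCHANGE lemma
`tendsto_integral_integral_kernel` — for a bounded density `ρ` vanishing off a ball and continuous kernels `κₙ`
with `|κₙ(y)| ≤ C‖y‖⁻⁶` and `κₙ(y) = c‖y‖⁻⁶` eventually (each `y ≠ 0`),
`∫ρ(x)∫ρ(z)κₙ(x - z) → c ∫ρ(x)∫ρ(z)‖x - z‖⁻⁶` (dominated convergence twice; the diagonal is Lebesgue-null).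

References: D. Gilbarg, N. S. Trudinger, *Elliptic PDE of second order* (2001), §2.4, Lemma 4.1;
E. H. Lieb, M. Loss, *Analysis* (2001), Thm 6.21, §9.7.
-/

noncomputable section

open MeasureTheory Set Filter Metric Topology InnerProductSpace Function
open scoped RealInnerProductSpace Laplacian ContDiff

namespace Summit.AtomisticToContinuum.Crystallization.Theorems.PricedLinkCensusLocalToGlobal

/-! ### Weighted decay and square integrability on `ℝ⁸` -/

/-- Peetre-type inequality: for `‖z‖ ≤ R₀` (`R₀ ≥ 0`), `(1 + ‖x - z‖)⁻¹ ≤ (1 + R₀)(1 + ‖x‖)⁻¹`. [folklore] -/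
theorem inv_one_add_norm_sub_le {x z : E8} {R₀ : ℝ} (hR₀ : 0 ≤ R₀) (hz : ‖z‖ ≤ R₀) :
    (1 + ‖x - z‖)⁻¹ ≤ (1 + R₀) * (1 + ‖x‖)⁻¹ := by
  rw [inv_eq_one_div, inv_eq_one_div, mul_one_div, div_le_div_iff₀ (by positivity) (by positivity), one_mul]
  have h1 : ‖x‖ ≤ ‖x - z‖ + ‖z‖ := norm_le_norm_sub_add x z
  nlinarith [norm_nonneg (x - z)]

/-- `(1 + ‖x‖)⁻ᵏ ∈ L²(ℝ⁸)` as soon as `k ≥ 5` (`2k > 8`); more generally any a.e.-strongly measurable `h`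
with `‖h(x)‖ ≤ C (1 + ‖x‖)⁻ᵏ` is square integrable. [folklore] -/
theorem memLp_two_of_le_weight {F : Type*} [NormedAddCommGroup F] {h : E8 → F}
    (hm : AEStronglyMeasurable h volume) {C : ℝ} {k : ℕ} (hk : 5 ≤ k)
    (hle : ∀ x, ‖h x‖ ≤ C * (1 + ‖x‖)⁻¹ ^ k) : MemLp h 2 volume := by
  have hC : 0 ≤ C := by
    have := (norm_nonneg _).trans (hle 0)
    rw [norm_zero, add_zero, inv_one, one_pow, mul_one] at this
    exact this
  set g : E8 → ℝ := fun x => C * (1 + ‖x‖)⁻¹ ^ k with hg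
  have hgm : AEStronglyMeasurable g volume := by
    exact (continuous_const.mul ((Continuous.inv₀ (continuous_const.add continuous_norm)
      fun x => (add_pos_of_pos_of_nonneg one_pos (norm_nonneg x)).ne').pow k)).aestronglyMeasurable
  have hg2 : MemLp g 2 volume := by
    rw [memLp_two_iff_integrable_sq hgm]
    have hr : (Module.finrank ℝ E8 : ℝ) < (2 * k : ℕ) := by
      rw [finrank_euclideanSpace_fin]; push_cast; linarith [show (5 : ℝ) ≤ k by exact_mod_cast hk]
    have hint := (integrable_one_add_norm (E := E8) (μ := volume) hr).const_mul (C ^ 2)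
    refine hint.congr (Eventually.of_forall fun x => ?_)
    simp only [hg]
    rw [Real.rpow_neg (by positivity), Real.rpow_natCast, mul_pow, ← pow_mul, inv_pow, mul_comm k 2]
  refine MemLp.of_le hg2 hm (Eventually.of_forall fun x => (hle x).trans ?_)
  rw [Real.norm_eq_abs]
  exact le_abs_self _

/-! ### Kernel exchange in the Coulomb double integral -/

/-- Off a Lebesgue-null set (a point), i.e. almost everywhere, `z ≠ x`. [folklore] -/
theorem ae_ne_point (x : E8) : ∀ᵐ z ∂(volume : Measure E8), z ≠ x := by
  simp [ae_iff, measure_singleton]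

variable {ρ : E8 → ℝ} {M R₀ : ℝ}

/-- The majorant `z ↦ 𝟙_{B̄(0,R₀)}(z) · M C ‖x - z‖⁻⁶` of `ρ(z) κ(x - z)` is integrable. [folklore] -/
theorem integrable_indicator_mul_inv_norm_sub_pow_six (x : E8) (M C R₀ : ℝ) :
    Integrable fun z : E8 => (closedBall (0 : E8) R₀).indicator (fun z => M * (C * ‖x - z‖⁻¹ ^ 6)) z := by
  rw [integrable_indicator_iff measurableSet_closedBall]
  exact (((integrableOn_inv_norm_sub_pow_six x 0 (R₀ + 1)).mono_set
    (closedBall_subset_ball (by linarith))).const_mul C).const_mul M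

/-- Its integral is at most `M C (3π⁴/2)(R₀ + 1)²` (`M, C, R₀ ≥ 0`). [folklore] -/
theorem integral_indicator_mul_inv_norm_sub_pow_six_le (x : E8) {M C R₀ : ℝ} (hM : 0 ≤ M) (hC : 0 ≤ C)
    (hR₀ : 0 ≤ R₀) :
    ∫ z : E8, (closedBall (0 : E8) R₀).indicator (fun z => M * (C * ‖x - z‖⁻¹ ^ 6)) z ≤
      M * (C * (3 / 2 * Real.pi ^ 4 * (R₀ + 1) ^ 2)) := by
  rw [integral_indicator measurableSet_closedBall, integral_const_mul, integral_const_mul]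
  refine mul_le_mul_of_nonneg_left (mul_le_mul_of_nonneg_left ?_ hC) hM
  calc ∫ z in closedBall (0 : E8) R₀, ‖x - z‖⁻¹ ^ 6 ≤ ∫ z in ball (0 : E8) (R₀ + 1), ‖x - z‖⁻¹ ^ 6 :=
        setIntegral_mono_set (integrableOn_inv_norm_sub_pow_six x 0 (R₀ + 1))
          (Eventually.of_forall fun z => by positivity)
          (Eventually.of_forall (closedBall_subset_ball (by linarith)))
    _ ≤ 3 / 2 * Real.pi ^ 4 * (R₀ + 1) ^ 2 := setIntegral_inv_norm_sub_pow_six_le x 0 (by linarith)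

/-- **Kernel exchange in the Coulomb double integral.** Let `ρ` be an integrable density with `|ρ| ≤ M`
vanishing off `B̄(0, R₀)`, and `κₙ` continuous kernels with `|κₙ(y)| ≤ C ‖y‖⁻⁶` and, for each `y ≠ 0`,
`κₙ(y) = c ‖y‖⁻⁶` for all large `n`.  Then `∫ρ(x) ∫ρ(z) κₙ(x - z) dz dx → c ∫ρ(x) ∫ρ(z) ‖x - z‖⁻⁶ dz dx`
(dominated convergence in `z` off the null diagonal `z = x`, then in `x`; the majorants come from the local
integrability of `‖·‖⁻⁶` in `ℝ⁸`). [cite: LiebLoss2001, Thm 9.8] -/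
theorem tendsto_integral_integral_kernel (hρi : Integrable ρ) (hρb : ∀ z, |ρ z| ≤ M)
    (hρ0 : ∀ z, R₀ < ‖z‖ → ρ z = 0) (hR₀ : 0 ≤ R₀) {κ : ℕ → E8 → ℝ} {C c : ℝ} (hC : 0 ≤ C)
    (hκc : ∀ n, Continuous (κ n)) (hκb : ∀ n y, y ≠ 0 → |κ n y| ≤ C * ‖y‖⁻¹ ^ 6)
    (hκ : ∀ y, y ≠ 0 → ∀ᶠ n in atTop, κ n y = c * ‖y‖⁻¹ ^ 6) :
    Tendsto (fun n => ∫ x, ρ x * ∫ z, ρ z * κ n (x - z)) atTop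
      (𝓝 (c * ∫ x, ρ x * ∫ z, ρ z * ‖x - z‖⁻¹ ^ 6)) := by
  have hM : 0 ≤ M := (abs_nonneg _).trans (hρb 0)
  have hρR : ∀ z, z ∉ closedBall (0 : E8) R₀ → ρ z = 0 := fun z hz =>
    hρ0 z (by rwa [mem_closedBall_zero_iff, not_le] at hz)
  set bound : E8 → E8 → ℝ := fun x z =>
    (closedBall (0 : E8) R₀).indicator (fun z => M * (C * ‖x - z‖⁻¹ ^ 6)) z with hbound_def
  -- the majorant of the inner integrands, valid off the diagonal
  have hbd : ∀ n x z, z ≠ x → ‖ρ z * κ n (x - z)‖ ≤ bound x z := fun n x z hz => by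
    by_cases hzR : z ∈ closedBall (0 : E8) R₀
    · rw [hbound_def]
      simp only
      rw [indicator_of_mem hzR, Real.norm_eq_abs, abs_mul]
      exact mul_le_mul (hρb z) (hκb n (x - z) (sub_ne_zero.2 (Ne.symm hz))) (abs_nonneg _) hM
    · rw [hρR z hzR, zero_mul, norm_zero]
      exact indicator_nonneg (fun _ _ => by positivity) _
  have hmeas : ∀ n x, AEStronglyMeasurable (fun z => ρ z * κ n (x - z)) volume := fun n x =>
    hρi.aestronglyMeasurable.mul ((hκc n).comp (continuous_const.sub continuous_id)).aestronglyMeasurable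
  -- Step 1: the inner integrals converge pointwise
  have h1 : ∀ x, Tendsto (fun n => ∫ z, ρ z * κ n (x - z)) atTop (𝓝 (c * ∫ z, ρ z * ‖x - z‖⁻¹ ^ 6)) := by
    intro x
    have hlim : c * ∫ z, ρ z * ‖x - z‖⁻¹ ^ 6 = ∫ z, ρ z * (c * ‖x - z‖⁻¹ ^ 6) := by
      rw [← integral_const_mul]
      exact integral_congr_ae (Eventually.of_forall fun z => by ring)
    rw [hlim]
    refine tendsto_integral_of_dominated_convergence (bound x) (fun n => hmeas n x)
      (integrable_indicator_mul_inv_norm_sub_pow_six x M C R₀) (fun n => ?_) ?_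
    · filter_upwards [ae_ne_point x] with z hz using hbd n x z hz
    · filter_upwards [ae_ne_point x] with z hz
      refine tendsto_const_nhds.congr' ?_
      filter_upwards [hκ (x - z) (sub_ne_zero.2 (Ne.symm hz))] with n hn
      rw [hn]
  -- the inner integrals are continuous in `x` and uniformly bounded
  have hcont : ∀ n, Continuous fun x => ∫ z, ρ z * κ n (x - z) := fun n =>
    Literature.Analysis.FluidPDE.continuous_integral_smul_comp_sub hρi hρ0 (hκc n)
  set B : ℝ := M * (C * (3 / 2 * Real.pi ^ 4 * (R₀ + 1) ^ 2)) with hB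
  have hib : ∀ n x, |∫ z, ρ z * κ n (x - z)| ≤ B := fun n x => by
    rw [← Real.norm_eq_abs]
    refine (norm_integral_le_of_norm_le (integrable_indicator_mul_inv_norm_sub_pow_six x M C R₀) ?_).trans
      (integral_indicator_mul_inv_norm_sub_pow_six_le x hM hC hR₀)
    filter_upwards [ae_ne_point x] with z hz using hbd n x z hz
  -- Step 2: dominated convergence in `x`
  have h2 : Tendsto (fun n => ∫ x, ρ x * ∫ z, ρ z * κ n (x - z)) atTop
      (𝓝 (∫ x, ρ x * (c * ∫ z, ρ z * ‖x - z‖⁻¹ ^ 6))) := by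
    refine tendsto_integral_of_dominated_convergence
      (fun x => (closedBall (0 : E8) R₀).indicator (fun _ => M * B) x)
      (fun n => hρi.aestronglyMeasurable.mul (hcont n).aestronglyMeasurable) ?_ (fun n => ?_) ?_
    · exact (integrable_indicator_iff measurableSet_closedBall).2
        (integrableOn_const (measure_closedBall_lt_top (x := (0 : E8)) (r := R₀)).ne)
    · refine Eventually.of_forall fun x => ?_
      by_cases hxR : x ∈ closedBall (0 : E8) R₀
      · rw [indicator_of_mem hxR, Real.norm_eq_abs, abs_mul]
        exact mul_le_mul (hρb x) (hib n x) (abs_nonneg _) hM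
      · rw [indicator_of_notMem hxR, hρR x hxR, zero_mul, norm_zero]
    · exact Eventually.of_forall fun x => (h1 x).const_mul (ρ x)
  have hlim : c * ∫ x, ρ x * ∫ z, ρ z * ‖x - z‖⁻¹ ^ 6 = ∫ x, ρ x * (c * ∫ z, ρ z * ‖x - z‖⁻¹ ^ 6) := by
    rw [← integral_const_mul]
    exact integral_congr_ae (Eventually.of_forall fun x => by ring)
  rw [hlim]
  exact h2

/-! ### The regularised potentials -/

variable {t : ℝ} {ρ : E8 → ℝ} {M R₀ : ℝ}

/-- `v ∈ Cⁿ` for every `n` (differentiation under the integral sign, tree `HarmonicProbe`). [folklore] -/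
theorem contDiff_farPotential (ht : 0 < t) (hρi : Integrable ρ) (hρ0 : ∀ z, R₀ < ‖z‖ → ρ z = 0) (n : ℕ) :
    ContDiff ℝ n (farPotential t ρ) :=
  Literature.Analysis.FluidPDE.contDiff_integral_smul_comp_sub hρi hρ0 n (contDiff_newtonFar8 ht)

/-- `Dv(x) = ∫ ρ(z) Df_t(x - z) dz`. [folklore] -/
theorem fderiv_farPotential (ht : 0 < t) (hρi : Integrable ρ) (hρ0 : ∀ z, R₀ < ‖z‖ → ρ z = 0) (x : E8) :
    fderiv ℝ (farPotential t ρ) x = ∫ z, ρ z • fderiv ℝ (newtonFar8 t) (x - z) :=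
  Literature.Analysis.FluidPDE.fderiv_integral_smul_comp_sub hρi hρ0 (contDiff_newtonFar8 ht) x

/-- `Δv(x) = ∫ ρ(z) (Δf_t)(x - z) dz`. [folklore] -/
theorem laplacian_farPotential (ht : 0 < t) (hρi : Integrable ρ) (hρ0 : ∀ z, R₀ < ‖z‖ → ρ z = 0) (x : E8) :
    (Δ (farPotential t ρ)) x = ∫ z, ρ z * (Δ (newtonFar8 t)) (x - z) :=
  Literature.Analysis.FluidPDE.laplacian_integral_mul_comp_sub hρi hρ0 (contDiff_newtonFar8 ht) x

/-- **Decay of the potential**: `|v(x)| ≤ M (1 + 2/t)⁶ (1 + R₀)⁶ vol(B̄(0,R₀)) · (1 + ‖x‖)⁻⁶`. [folklore] -/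
theorem abs_farPotential_le (ht : 0 < t) (hρb : ∀ z, |ρ z| ≤ M) (hρ0 : ∀ z, R₀ < ‖z‖ → ρ z = 0)
    (hR₀ : 0 ≤ R₀) (x : E8) :
    |farPotential t ρ x| ≤ M * (1 + 2 / t) ^ 6 * (1 + R₀) ^ 6 * (volume : Measure E8).real (closedBall 0 R₀) *
      (1 + ‖x‖)⁻¹ ^ 6 := by
  have hM : 0 ≤ M := (abs_nonneg _).trans (hρb 0)
  set K : ℝ := M * (1 + 2 / t) ^ 6 * (1 + R₀) ^ 6 * (1 + ‖x‖)⁻¹ ^ 6 with hK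
  have hbd : ∀ z, ‖ρ z * newtonFar8 t (x - z)‖ ≤ (closedBall (0 : E8) R₀).indicator (fun _ => K) z := fun z => by
    by_cases hz : z ∈ closedBall (0 : E8) R₀
    · rw [indicator_of_mem hz, Real.norm_eq_abs, abs_mul]
      have h1 := abs_newtonFar8_le_weight ht (x - z)
      have h2 : (1 + ‖x - z‖)⁻¹ ^ 6 ≤ ((1 + R₀) * (1 + ‖x‖)⁻¹) ^ 6 :=
        pow_le_pow_left₀ (by positivity) (inv_one_add_norm_sub_le hR₀ (mem_closedBall_zero_iff.1 hz)) 6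
      calc |ρ z| * |newtonFar8 t (x - z)| ≤ M * ((1 + 2 / t) ^ 6 * ((1 + R₀) * (1 + ‖x‖)⁻¹) ^ 6) :=
          mul_le_mul (hρb z) (h1.trans (mul_le_mul_of_nonneg_left h2 (by positivity))) (abs_nonneg _) hM
        _ = K := by rw [hK]; ring
    · rw [indicator_of_notMem hz, hρ0 z (by rwa [mem_closedBall_zero_iff, not_le] at hz), zero_mul, norm_zero]
  have hint : Integrable (fun z => (closedBall (0 : E8) R₀).indicator (fun _ => K) z) :=
    (integrable_indicator_iff measurableSet_closedBall).2
      (integrableOn_const (measure_closedBall_lt_top (x := (0 : E8)) (r := R₀)).ne)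
  rw [farPotential, ← Real.norm_eq_abs]
  refine (norm_integral_le_of_norm_le hint (Eventually.of_forall hbd)).trans_eq ?_
  rw [integral_indicator measurableSet_closedBall, setIntegral_const, smul_eq_mul, hK]
  ring

/-- **Decay of the gradient**: `‖Dv(x)‖ ≤ C₁ (1 + ‖x‖)⁻⁷` for some `C₁`. [folklore] -/
theorem exists_norm_fderiv_farPotential_le (ht : 0 < t) (hρi : Integrable ρ) (hρb : ∀ z, |ρ z| ≤ M)
    (hρ0 : ∀ z, R₀ < ‖z‖ → ρ z = 0) (hR₀ : 0 ≤ R₀) :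
    ∃ C₁ : ℝ, ∀ x : E8, ‖fderiv ℝ (farPotential t ρ) x‖ ≤ C₁ * (1 + ‖x‖)⁻¹ ^ 7 := by
  have hM : 0 ≤ M := (abs_nonneg _).trans (hρb 0)
  obtain ⟨A, hA0, hA⟩ := exists_norm_fderiv_newtonFar8_le_weight ht
  refine ⟨M * A * (1 + R₀) ^ 7 * (volume : Measure E8).real (closedBall 0 R₀), fun x => ?_⟩
  set K : ℝ := M * A * (1 + R₀) ^ 7 * (1 + ‖x‖)⁻¹ ^ 7 with hK
  have hbd : ∀ z, ‖ρ z • fderiv ℝ (newtonFar8 t) (x - z)‖ ≤ (closedBall (0 : E8) R₀).indicator (fun _ => K) z :=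
    fun z => by
    by_cases hz : z ∈ closedBall (0 : E8) R₀
    · rw [indicator_of_mem hz, norm_smul, Real.norm_eq_abs]
      have h2 : (1 + ‖x - z‖)⁻¹ ^ 7 ≤ ((1 + R₀) * (1 + ‖x‖)⁻¹) ^ 7 :=
        pow_le_pow_left₀ (by positivity) (inv_one_add_norm_sub_le hR₀ (mem_closedBall_zero_iff.1 hz)) 7
      calc |ρ z| * ‖fderiv ℝ (newtonFar8 t) (x - z)‖ ≤ M * (A * ((1 + R₀) * (1 + ‖x‖)⁻¹) ^ 7) :=
          mul_le_mul (hρb z) ((hA _).trans (mul_le_mul_of_nonneg_left h2 hA0)) (norm_nonneg _) hM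
        _ = K := by rw [hK]; ring
    · rw [indicator_of_notMem hz, hρ0 z (by rwa [mem_closedBall_zero_iff, not_le] at hz), zero_smul, norm_zero]
  have hint : Integrable (fun z => (closedBall (0 : E8) R₀).indicator (fun _ => K) z) :=
    (integrable_indicator_iff measurableSet_closedBall).2
      (integrableOn_const (measure_closedBall_lt_top (x := (0 : E8)) (r := R₀)).ne)
  rw [fderiv_farPotential ht hρi hρ0]
  refine (norm_integral_le_of_norm_le hint (Eventually.of_forall hbd)).trans_eq ?_
  rw [integral_indicator measurableSet_closedBall, setIntegral_const, smul_eq_mul, hK]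
  ring

/-- `v ∈ L²(ℝ⁸)`. [folklore] -/
theorem memLp_farPotential (ht : 0 < t) (hρi : Integrable ρ) (hρb : ∀ z, |ρ z| ≤ M)
    (hρ0 : ∀ z, R₀ < ‖z‖ → ρ z = 0) (hR₀ : 0 ≤ R₀) : MemLp (farPotential t ρ) 2 volume :=
  memLp_two_of_le_weight (contDiff_farPotential ht hρi hρ0 0).continuous.aestronglyMeasurable
    (by norm_num : 5 ≤ 6) fun x => by rw [Real.norm_eq_abs]; exact abs_farPotential_le ht hρb hρ0 hR₀ x

/-- `∇v ∈ L²(ℝ⁸; ℝ⁸)`. [folklore] -/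
theorem memLp_gradient_farPotential (ht : 0 < t) (hρi : Integrable ρ) (hρb : ∀ z, |ρ z| ≤ M)
    (hρ0 : ∀ z, R₀ < ‖z‖ → ρ z = 0) (hR₀ : 0 ≤ R₀) : MemLp (gradient (farPotential t ρ)) 2 volume := by
  obtain ⟨C₁, hC₁⟩ := exists_norm_fderiv_farPotential_le ht hρi hρb hρ0 hR₀
  have hc : Continuous (gradient (farPotential t ρ)) :=
    Literature.Analysis.FluidPDE.continuous_gradient_of_contDiff (contDiff_farPotential ht hρi hρ0 1)
  refine memLp_two_of_le_weight hc.aestronglyMeasurable (C := C₁) (by norm_num : 5 ≤ 7) fun x => ?_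
  rw [gradient, LinearIsometryEquiv.norm_map]
  exact hC₁ x

/-! ### The Laplacian of the potential and the energy identity -/

/-- `Δv` is continuous. [folklore] -/
theorem continuous_laplacian_farPotential (ht : 0 < t) (hρi : Integrable ρ) (hρ0 : ∀ z, R₀ < ‖z‖ → ρ z = 0) :
    Continuous (Δ (farPotential t ρ)) :=
  Literature.Analysis.FluidPDE.continuous_laplacian (contDiff_farPotential ht hρi hρ0 2)

/-- `Δv(x) = 0` for `‖x‖ > R₀ + 2t` (`Δ f_t` lives in `B̄(0, 2t)`, `ρ` in `B̄(0, R₀)`). [folklore] -/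
theorem laplacian_farPotential_eq_zero (ht : 0 < t) (hρi : Integrable ρ) (hρ0 : ∀ z, R₀ < ‖z‖ → ρ z = 0)
    {x : E8} (hx : R₀ + 2 * t < ‖x‖) : (Δ (farPotential t ρ)) x = 0 := by
  rw [laplacian_farPotential ht hρi hρ0 x]
  refine (integral_congr_ae (Eventually.of_forall fun z => ?_)).trans (integral_zero _ _)
  show ρ z * (Δ (newtonFar8 t)) (x - z) = 0
  by_cases hz : R₀ < ‖z‖
  · rw [hρ0 z hz, zero_mul]
  · rw [laplacian_newtonFar8_eq_zero_of_le ht, mul_zero]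
    have := norm_sub_norm_le x z
    rw [not_lt] at hz
    linarith

/-- `Δv` has compact support. [folklore] -/
theorem hasCompactSupport_laplacian_farPotential (ht : 0 < t) (hρi : Integrable ρ)
    (hρ0 : ∀ z, R₀ < ‖z‖ → ρ z = 0) : HasCompactSupport (Δ (farPotential t ρ)) := by
  refine HasCompactSupport.intro (isCompact_closedBall (0 : E8) (R₀ + 2 * t)) fun x hx => ?_
  rw [mem_closedBall_zero_iff, not_le] at hx
  exact laplacian_farPotential_eq_zero ht hρi hρ0 hx

/-- **`∇g` has weak divergence `Δg`**: `∫ ⟪∇g, ∇φ⟫ = -∫ Δg φ` for `g ∈ C²` and `φ ∈ C¹_c` (Green's first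
identity without boundary terms). [cite: Evans2010, App. C.2 Thm 3] -/
theorem integral_inner_gradient_gradient_eq {E : Type*} [NormedAddCommGroup E] [InnerProductSpace ℝ E]
    [FiniteDimensional ℝ E] [MeasurableSpace E] [BorelSpace E] {g : E → ℝ} (hg : ContDiff ℝ 2 g)
    {φ : E → ℝ} (hφ : ContDiff ℝ 1 φ) (hφc : HasCompactSupport φ) :
    ∫ x, ⟪gradient g x, gradient φ x⟫ = -∫ x, (Δ g) x * φ x := by
  have hgrad : ContDiff ℝ 1 (gradient g) :=
    (InnerProductSpace.toDual ℝ E).symm.contDiff.comp (hg.fderiv_right (m := 1) le_rfl)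
  have h := Literature.Analysis.FluidPDE.integral_mul_divergence_add_eq_zero_left hφ hgrad hφc
  have h1 : ∫ x, φ x * Literature.Analysis.FluidPDE.VectorCalculus.divergence (gradient g) x =
      ∫ x, (Δ g) x * φ x :=
    integral_congr_ae (Eventually.of_forall fun x => by
      simp only; rw [Literature.Analysis.FluidPDE.divergence_gradient hg, mul_comm])
  linarith

/-- **Energy identity for the regularised potential**: `∫ ⟪∇v, ∇v⟫ = -∫ Δv · v` (`v, ∇v ∈ L²`, `Δv`
continuous with compact support; cut-off removal). [cite: LiebLoss2001, Thm 7.7] -/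
theorem integral_inner_gradient_farPotential_self (ht : 0 < t) (hρi : Integrable ρ) (hρb : ∀ z, |ρ z| ≤ M)
    (hρ0 : ∀ z, R₀ < ‖z‖ → ρ z = 0) (hR₀ : 0 ≤ R₀) :
    ∫ x, ⟪gradient (farPotential t ρ) x, gradient (farPotential t ρ) x⟫ =
      -∫ x, (Δ (farPotential t ρ)) x * farPotential t ρ x := by
  have h2 : ContDiff ℝ 2 (farPotential t ρ) := contDiff_farPotential ht hρi hρ0 2
  refine integral_inner_gradient_eq_of_weakDiv (memLp_gradient_farPotential ht hρi hρb hρ0 hR₀)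
    (h2.of_le one_le_two) (memLp_farPotential ht hρi hρb hρ0 hR₀)
    (memLp_gradient_farPotential ht hρi hρb hρ0 hR₀) ?_
    (fun φ hφ hφc => integral_inner_gradient_gradient_eq h2 hφ hφc)
  exact ((continuous_laplacian_farPotential ht hρi hρ0).mul h2.continuous).integrable_of_hasCompactSupport
    ((hasCompactSupport_laplacian_farPotential ht hρi hρ0).mul_right)

/-- **Registered sub-goal `farPotential_energy`** (line `flux-cell-joint-census`, support of `stub_confinedThomson`):
the energy identity of the regularised potential, binder form of `integral_inner_gradient_farPotential_self`.
[cite: LiebLoss2001, Thm 7.7] -/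
theorem farPotential_energy : ∀ (t : ℝ) (ρ : E8 → ℝ) (M R₀ : ℝ), 0 < t →
    MeasureTheory.Integrable ρ MeasureTheory.volume → (∀ z, |ρ z| ≤ M) → (∀ z, R₀ < ‖z‖ → ρ z = 0) → 0 ≤ R₀ →
    ∫ x, inner ℝ (gradient (farPotential t ρ) x) (gradient (farPotential t ρ) x) =
      -∫ x, (Δ (farPotential t ρ)) x * farPotential t ρ x :=
  fun _ _ _ _ ht hρi hρb hρ0 hR₀ => integral_inner_gradient_farPotential_self ht hρi hρb hρ0 hR₀

end Summit.AtomisticToContinuum.Crystallization.Theorems.PricedLinkCensusLocalToGlobal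

end
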